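import Summits.MatrixMultiplication.OmegaCensus.SmallFormats.MatMul228GF3NoK4
import Summits.MatrixMultiplication.OmegaCensus.SmallFormats.MatMul22nRankGF3Ladder3
import HarnessLib

/-!
# ω-census family (a): `R_𝔽₃(⟨2,2,8⟩) = 28` conditional on FOURTEEN exclusions — the kill-list obligation after the K4 word

Cell `pub-omega` (unit `pub-omega-tensor`, gen 42), topic `Summits/MatrixMultiplication/OmegaCensus` (sub-folder `SmallFormats`). Framing (verbatim): lottery
ticket; floor = certified bounds/negative ranges. HONEST FRAMING: bookkeeping. `Cover827.tensorRank_228_gf3_eq_of_exclusion` (tensor g41, p750885) makes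
«R_𝔽₃(⟨2,2,8⟩) = 28» conditional on the exclusion of the fifteen kill-list marginals `Cover827.REP827 j` (`j < 15`); the kernel word `NoK4.xMarginal_ne_K4`
(this seat, p759750) discharges `j = 3`. This file records the remaining obligation: the fourteen marginals `j ∈ {0,…,14} ∖ {3}` (`tensorRank_228_gf3_eq_of_exclusion14`),
and the corresponding status line. Nothing here is «R_𝔽₃(⟨2,2,8⟩) = 28»; nothing on `ω`.
-/

namespace Summit.MatrixMultiplication.OmegaCensus.SmallFormats

open Literature.Computability.AlgebraicComplexity
open Summit.MatrixMultiplication.OmegaCensus.RankOnePlaneCapGeneral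

namespace Cover827

/-- **`R_𝔽₃(⟨2,2,8⟩) = 28` conditional on the exclusion of the FOURTEEN kill-list marginals `REP827 j`, `j < 15`, `j ≠ 3`** (K4 = `REP827 3` is excluded in the
kernel by `NoK4.xMarginal_ne_K4`). -/
theorem tensorRank_228_gf3_eq_of_exclusion14
    (hexcl : ∀ j, j < 15 → j ≠ 3 → ∀ β : BilinComp (mulBilin (ZMod 3) 2 2 8) (Fin 27), xMarginal β ≠ REP827 j) :
    tensorRank (matMulTensor (ZMod 3) 2 2 8) = 28 := by
  refine tensorRank_228_gf3_eq_of_exclusion fun j hj β => ?_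
  by_cases h3 : j = 3
  · subst h3; exact NoK4.xMarginal_ne_K4 β
  · exact hexcl j hj h3 β

/-- The `n = 8` rung with its remaining obligation after the K4 word: `R_𝔽₃(⟨2,2,8⟩) ∈ [27, 28]`, and `= 28` as soon as none of the fourteen marginals
`REP827 j` (`j < 15`, `j ≠ 3`) is the X-marginal of a 27-term computation. -/
theorem tensorRank_228_gf3_status14 :
    tensorRank (matMulTensor (ZMod 3) 2 2 8) ∈ Set.Icc 27 28 ∧
    ((∀ j, j < 15 → j ≠ 3 → ∀ β : BilinComp (mulBilin (ZMod 3) 2 2 8) (Fin 27), xMarginal β ≠ REP827 j) →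
      tensorRank (matMulTensor (ZMod 3) 2 2 8) = 28) :=
  ⟨(tensorRank_matMulTensor_22n_gf3_ladder_5_12''.2.2.2.1), tensorRank_228_gf3_eq_of_exclusion14⟩

end Cover827

end Summit.MatrixMultiplication.OmegaCensus.SmallFormats
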